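import Summits.CriticalPhenomena.Ising3DConformalLimit.Theorems.MirrorHoelderCompactnessTwoPointDoublingStubGreenComparison
import Summits.CriticalPhenomena.Ising3DConformalLimit.Theorems.MirrorHoelderCompactnessTwoPointDoublingStubDlrLaplacian
import Summits.CriticalPhenomena.Ising3DConformalLimit.Theorems.HyperoctahedralRPExistsScaleCovariantLimitFoldedCurrentEngineIffDoubling
import Summits.CriticalPhenomena.Ising3DConformalLimit.Theorems.HyperoctahedralRPExistsScaleCovariantLimitCompactnessItemMapsDoubling
import Summits.CriticalPhenomena.Ising3DConformalLimit.Theorems.HyperoctahedralRPExistsScaleCovariantLimitSplitGlue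
import Summits.CriticalPhenomena.Ising3DConformalLimit.Theses.MirrorHoelderCompactness
import HarnessLib

/-!
# Funnel edge of a new kind for item 6150 and crux 1981: NO POSITIVE EFFECTIVE MASS ⟹ doubling ⟹ compactness

Importable arrows assembled from the two landed stubs of the 6150 strategist line `superharmonic-comparison`
(`stub_dlrLaplacian`, p173705; `stub_greenComparison`, p173658) — the line's composition `TwoPointDoubling_of` lives in a
`Cruxes/` workfile; here it is in `Theorems/`, by name, for planners and for the funnel of crux stmt-CriticalPhenomena-1981:

* `twoPointDoubling_of_oneSidedKato` — the one-sided scale-invariant Kato bound in LAPLACIAN form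
  `∃ A, ∀ x ≠ 0, ΔG(x) ≤ A·G(x)/‖x‖²` (`G = criticalTwoPoint 3`) implies item 6150 `TwoPointDoubling` (all-scale axis
  doubling) — this is `stub_greenComparison` with the conclusion named;
* `twoPointDoubling_of_oneSidedKatoDLR` — the same from the DLR form `∃ A, ∀ x ≠ 0, ⟨σ₀·(S_x − 6 tanh(β_c S_x))⟩⁺ ≤ A·G(x)/‖x‖²`
  (the OPEN core `stub_oneSidedKatoDLR` of the line, an inequality among correlations of `σ₀` with odd local functions of the
  six neighbours of `x`), through the DLR reading of the Laplacian `stub_dlrLaplacian`;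
* consequences down the landed funnel: `orbitPrecompact_of_oneSidedKato` (item 5955, `orbitPrecompact_iff_doubling` p120504),
  `uniformRegularity_of_oneSidedKato` (item 4658), `wallRepulsion_of_oneSidedKato` (the engine F2 of line
  `folded-current-repulsion`, `wallRepulsion_iff_twoPointDoubling` p138231);
* `crux_of_oneSidedKato_of_totallyDisconnected` — under the Kato bound, crux 1981 `ExistsScaleCovariantLimit` follows from
  item 4659 `ClusterSetTotallyDisconnected` ALONE (`SplitGlue.hrp_crux_of_doubling_of_totallyDisconnected`, p154899).

Why this is not in the refuted technique class `Literature.Barriers.CriticalPhenomena.AxisProfileAxiomaticsNoDoubling`: the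
hypothesis is a LOCAL statement about the full lattice function (one point, the lattice-scale operator `Δ`), not a fact about the
axis profile; the barrier's lacunary witnesses `Y = Σᵢ wᵢ e^{−r/Mᵢ}/r` have `ΔY·r²/Y ≈ (r/Mᵢ)² → ∞` on their massive episodes
and violate it.  No `sorry`; axioms propext / Classical.choice / Quot.sound; no definitions.

References: M. Aizenman, H. Duminil-Copin, Ann. of Math. 194 (2021), arXiv:1912.07973, Remark 5.10 [AizenmanDuminilCopinAnnals2021];
S. Friedli, Y. Velenik, *Statistical Mechanics of Lattice Systems* (2017), Lemma 6.7 (heat-bath identity) [FriedliVelenik2017].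
-/

noncomputable section

open scoped BigOperators
open Literature.Probability.LatticeModels
open Summit.CriticalPhenomena.Ising3DConformalLimit.Theses
open Summit.CriticalPhenomena.Ising3DConformalLimit.Cruxes.ExistsScaleCovariantLimit

namespace Summit.CriticalPhenomena.Ising3DConformalLimit.Cruxes.TwoPointDoubling.SuperharmonicComparison

/-- **No positive effective mass ⟹ item 6150.** If `ΔG(x) ≤ A·G(x)/‖x‖²` for every `x ≠ 0` (`G = criticalTwoPoint 3`,
six-neighbour lattice Laplacian, sup norm on `ℤ³`), then `TwoPointDoubling` holds: `∃ κ > 0, ∀ n ≥ 1, κ·g(n) ≤ g(2n)`.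
This is the landed stub `stub_greenComparison` (comparison principle) with its conclusion named.
[cite: AizenmanDuminilCopinAnnals2021, arXiv:1912.07973 Remark 5.10] -/
theorem twoPointDoubling_of_oneSidedKato
    (h : ∃ A : ℝ, ∀ x : Site 3, x ≠ 0 →
      (∑ i : Fin 3, (criticalTwoPoint 3 (x + Pi.single i 1) + criticalTwoPoint 3 (x - Pi.single i 1))) -
        6 * criticalTwoPoint 3 x ≤ A * criticalTwoPoint 3 x / ‖x‖ ^ 2) :
    MirrorHoelderCompactness.TwoPointDoubling :=
  stub_greenComparison h

/-- **The DLR form: `stub_oneSidedKatoDLR` ⟹ item 6150.** If `⟨σ₀·(S_x − 6 tanh(β_c S_x))⟩⁺_{β_c} ≤ A·G(x)/‖x‖²` for every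
`x ≠ 0` (`S_x = Σᵢ (σ_{x+eᵢ} + σ_{x−eᵢ})`), then `TwoPointDoubling` holds — through the heat-bath reading of the lattice Laplacian
`stub_dlrLaplacian` (`ΔG(x) = ⟨σ₀·(S_x − 6 tanh(β_c S_x))⟩⁺`). [cite: FriedliVelenik2017, Lemma 6.7, eq. (6.5) and Thm. 6.26]
[cite: AizenmanDuminilCopinAnnals2021, arXiv:1912.07973 Remark 5.10] -/
theorem twoPointDoubling_of_oneSidedKatoDLR
    (h : ∃ A : ℝ, ∀ x : Site 3, x ≠ 0 →
      plusExpect 3 (criticalBeta 3) 0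
        (fun σ => spinAt 0 σ *
          ((∑ i : Fin 3, (spinAt (x + Pi.single i 1) σ + spinAt (x - Pi.single i 1) σ)) -
            6 * Real.tanh (criticalBeta 3 *
              ∑ i : Fin 3, (spinAt (x + Pi.single i 1) σ + spinAt (x - Pi.single i 1) σ)))) ≤
        A * criticalTwoPoint 3 x / ‖x‖ ^ 2) :
    MirrorHoelderCompactness.TwoPointDoubling := by
  obtain ⟨A, hA⟩ := h
  refine twoPointDoubling_of_oneSidedKato ⟨A, fun x hx => ?_⟩
  rw [stub_dlrLaplacian x hx]
  exact hA x hx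

/-- No positive effective mass ⟹ item 5955 `OrbitPrecompact` (through 6150 and `orbitPrecompact_iff_doubling`, p120504).
[cite: AizenmanDuminilCopinAnnals2021, arXiv:1912.07973 Remark 5.10] -/
theorem orbitPrecompact_of_oneSidedKato
    (h : ∃ A : ℝ, ∀ x : Site 3, x ≠ 0 →
      (∑ i : Fin 3, (criticalTwoPoint 3 (x + Pi.single i 1) + criticalTwoPoint 3 (x - Pi.single i 1))) -
        6 * criticalTwoPoint 3 x ≤ A * criticalTwoPoint 3 x / ‖x‖ ^ 2) :
    MonotoneRG.OrbitPrecompact :=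
  TwoHierarchies.ItemMaps.orbitPrecompact_iff_doubling.2 (twoPointDoubling_of_oneSidedKato h)

/-- No positive effective mass ⟹ item 4658 `UniformRegularity` (through 6150 and `uniformRegularity_iff_doubling`, p120504).
[cite: AizenmanDuminilCopinAnnals2021, arXiv:1912.07973 Remark 5.10] -/
theorem uniformRegularity_of_oneSidedKato
    (h : ∃ A : ℝ, ∀ x : Site 3, x ≠ 0 →
      (∑ i : Fin 3, (criticalTwoPoint 3 (x + Pi.single i 1) + criticalTwoPoint 3 (x - Pi.single i 1))) -
        6 * criticalTwoPoint 3 x ≤ A * criticalTwoPoint 3 x / ‖x‖ ^ 2) :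
    MonotoneRG.UniformRegularity :=
  TwoHierarchies.ItemMaps.uniformRegularity_iff_doubling.2 (twoPointDoubling_of_oneSidedKato h)

/-- No positive effective mass ⟹ the engine F2 `WallRepulsion` of line `folded-current-repulsion` of crux 1981
(through 6150 and `wallRepulsion_iff_twoPointDoubling`, p138231). [cite: AizenmanDuminilCopinAnnals2021, arXiv:1912.07973 Remark 5.10] -/
theorem wallRepulsion_of_oneSidedKato
    (h : ∃ A : ℝ, ∀ x : Site 3, x ≠ 0 →
      (∑ i : Fin 3, (criticalTwoPoint 3 (x + Pi.single i 1) + criticalTwoPoint 3 (x - Pi.single i 1))) -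
        6 * criticalTwoPoint 3 x ≤ A * criticalTwoPoint 3 x / ‖x‖ ^ 2) :
    FoldedCurrentRepulsion.WallRepulsion :=
  FoldedCurrentRepulsion.wallRepulsion_iff_twoPointDoubling.2 (twoPointDoubling_of_oneSidedKato h)

/-- **Under the one-sided Kato bound, crux 1981 follows from item 4659 alone**: `ExistsScaleCovariantLimit` (route
HyperoctahedralRP's copy of the shared decl; every other route copy has the same body) from `ClusterSetTotallyDisconnected`,
through 6150 and the split glue `SplitGlue.hrp_crux_of_doubling_of_totallyDisconnected` (p154899).
[cite: DuminilCopinICM2022, §8.4 p. 29] [cite: AizenmanDuminilCopinAnnals2021, arXiv:1912.07973 Remark 5.10] -/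
theorem crux_of_oneSidedKato_of_totallyDisconnected
    (h : ∃ A : ℝ, ∀ x : Site 3, x ≠ 0 →
      (∑ i : Fin 3, (criticalTwoPoint 3 (x + Pi.single i 1) + criticalTwoPoint 3 (x - Pi.single i 1))) -
        6 * criticalTwoPoint 3 x ≤ A * criticalTwoPoint 3 x / ‖x‖ ^ 2)
    (htd : ClusterRigidity.ClusterSetTotallyDisconnected) :
    HyperoctahedralRP.ExistsScaleCovariantLimit :=
  SplitGlue.hrp_crux_of_doubling_of_totallyDisconnected (twoPointDoubling_of_oneSidedKato h) htd

end Summit.CriticalPhenomena.Ising3DConformalLimit.Cruxes.TwoPointDoubling.SuperharmonicComparison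

end
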